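import Literature.Computability.Complexity.IKWGeneratorsProofs
import Literature.Computability.Complexity.Williams2014LowerBoundProofs
import HarnessLib

/-!
# Discharges of named facts of `Williams2014.lean`

`Literature/Computability/Complexity/Williams2014Holds.lean` — proofs-only sibling of
`Williams2014.lean` (no definitions, no named facts). Each theorem below closes a named fact
`X : Prop` of that file as `X_holds : X` by composing an ACCEPTED reduction theorem of the
tree with the ACCEPTED unconditional `_holds` discharges of all of its hypotheses; nothing is
re-proved and no statement is changed. Recorded by the librarian sweep g25 (2026-08-16, pass
5c: facts dischargeable in one line from the tree's own lemmas), so that the facts census,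
`#h21_route_deps` and the cone guardrail see these facts as theorems.

Discharged here:

* `Williams2014_lowerBound_of_accSat_holds` := `Williams2014_lowerBound_of_accSat_of_thm12_2`
  `IKW2002_thm12_2_holds` (`Williams2014LowerBoundProofs.lean`).

## References

* [Williams2014] — see `lean/references.bib` and the docstring of the fact in `Williams2014.lean`.
-/

namespace Literature.Computability.Complexity

/-- **Discharge of the named fact `Williams2014_lowerBound_of_accSat`** (`Williams2014.lean`):
Williams' algorithms-to-lower-bounds transfer for `ACC` (Williams 2014, Thm. 1.3, specialised
to the circuit class `C = ACC`; proved there from Lemma 3.1, Thm. 3.2, Lemma 5.1, Thm. … —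
obtained as `Williams2014_lowerBound_of_accSat_of_thm12_2` applied to the tree's unconditional
discharge `IKW2002_thm12_2_holds` of its hypothesis (reduction in
`Williams2014LowerBoundProofs.lean`).
[cite: Williams2014, Thm. 1.3] -/
theorem Williams2014_lowerBound_of_accSat_holds :
    Williams2014_lowerBound_of_accSat :=
  Williams2014_lowerBound_of_accSat_of_thm12_2 IKW2002_thm12_2_holds

end Literature.Computability.Complexity
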